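import Mathlib.Analysis.Fourier.FiniteAbelian.PontryaginDuality
import Mathlib.Analysis.Complex.Basic
import Mathlib.LinearAlgebra.Trace
import Mathlib.LinearAlgebra.Dimension.FreeAndStrongRankCondition
import Literature.RepresentationTheory.TwistedCoinvariantsCompactIsotypic
import HarnessLib

/-!
# Types of a smooth representation of a compact abelian group: the finite-level trace identity and its
# vanishing under a period of the type set

Topic `RepresentationTheory`; namespace `Literature.RepresentationTheory.TwistedCoinv` (continuing
`TwistedCoinvariants`, `TwistedCoinvariantsCompactIsotypic`).  KERNEL ONLY: theorems, 0 definitions, 0 named facts,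
0 `sorry`.

Setting: `K` a compact topological group whose elements commute (hypothesis `hcomm`, no `CommGroup` instance is
assumed — the target is the norm-one torus `E_v¹ = U(J₁)(F_v)`, whose type carries only a `Group` instance),
`ρ : Representation ℂ K S` SMOOTH (`Representation.IsSmooth`), `K₀ ≤ K` an OPEN subgroup, `S^{K₀} = ρ.fixedPoints K₀`
the `K₀`-fixed vectors (tree `SmoothRepresentation.lean`), and for a character `χ : K →* ℂˣ` the `χ`-isotypic
subspace `weightSpace ρ id χ = {v | ∀ k, ρ k v = χ k • v}` (tree `CharacterIsotypicSubspace.lean`), which for `K`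
compact, `ρ` smooth and `ker χ` open is the `χ`-coinvariants `Coinv ρ χ` (tree `exists_linearEquiv_weightSpace_coinv`).

* §1 (finite abelian group `A`, finite-dimensional `W`, `τ : Representation ℂ A W`; pure algebra).  The isotypic
  projectors `P_ψ = Σ_a ψ(a)⁻¹ τ(a)` (`ψ` a complex character of `A`, Mathlib `AddChar (Additive A) ℂ`):
  `τ(t) P_ψ = ψ(t) P_ψ` (`mul_sum_smul_eq`), `Σ_ψ P_ψ = |A| · 1` (`sum_sum_smul_eq`, character orthogonality
  `AddChar.sum_apply_eq_ite`), `|A|⁻¹ P_ψ` is a projection onto the weight space of `ψ` (`isProj_weightSpace`), hence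
  **the trace identity** `tr τ(t) = Σ_ψ ψ(t) · dim W[ψ]` (`trace_eq_sum_finrank_weightSpace`) and its consequence
  **`trace_eq_zero_of_finrank_weightSpace_periodic`**: if `dim W[ψ] = dim W[ψ η]` for all `ψ` then `tr τ(t) = 0`
  whenever `η(t) ≠ 1` (re-index the sum by `ψ ↦ ψ η`).
* §2 (compact `K` with commuting elements, open `K₀ ≤ K`).  Bookkeeping: characters trivial on `K₀` are continuous
  (`continuous_coe_of_le_ker`) and unitary (`norm_coe_eq_one_of_le_ker`); the weight spaces of a representation of
  `K/K₀` on `S^{K₀}` through which `ρ` acts have the dimensions of the corresponding weight spaces of `S`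
  (`finrank_weightSpace_quotient_eq`).  **`finite_fixedPoints_of_finite_weightSpace`** (with the corollaries
  `finite_fixedPoints_of_rank_weightSpace_le`, `finite_fixedPoints_of_finiteDimensional_weightSpace` = piece (M2a)):
  if the weight spaces of the characters trivial on `K₀` (resp. of every open-kernel character, resp. of every unitary
  continuous character) are finite-dimensional, so is `S^{K₀}` — it is the sum of the finitely many weight spaces of the
  characters of the finite group `K/K₀`.  **`trace_fixedPoints_eq_zero_of_periodic`** (piece (M2c)): if
  `dim S[ξ] = dim S[ξ η]` for every character `ξ` trivial on `K₀` (`K₀ ≤ ker η`) then `tr (ρ(t) | S^{K₀}) = 0` for every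
  `t` with `η(t) ≠ 1`.  **`trace_fixedPoints_eq_zero_of_coinv_periodic_of_le_ker`** (with the corollaries
  `trace_fixedPoints_eq_zero_of_coinv_periodic` — multiplicity one as «rank `≤ 1` for open-kernel characters» — and
  `trace_fixedPoints_eq_zero_of_coinv_periodic'` — multiplicity one as «finite-dimensional of dimension `≤ 1` for
  unitary continuous characters» = piece (M2d)): for `ρ` SMOOTH with multiplicity one, the same conclusion from the
  PERIODICITY OF THE TYPE SET in the coinvariant form «for every unitary continuous `ξ`,
  `Coinv ρ ξ ≠ 0 ↔ Coinv ρ (ξ η) ≠ 0`».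

This is piece (M2) of the ε-free «character route» to the rank `1 × 1` non-periodicity `hNP` of
`MoeglinVignerasWaldspurger1987/RankOneThetaLiftTwistRigidityOfNonPeriodic.lean` (cell hodgecm-mathlib, director
batch 12, 2026-08-28): with (M1) multiplicity one for `ω_s|E_v¹` and (TR) `tr (ω_s(t) | 𝒮^{K}) ≠ 0` for `t ≠ 1` and
`K` small, the last theorem gives the contradiction.  HC_CM is NOT advanced by this file alone; it is proved only
modulo the printed citations until rung 0 of the ladder closes.

## References
* [BernsteinZelevinsky1976] I. N. Bernstein, A. V. Zelevinsky, Russian Math. Surveys 31 (1976), §2.1–2.3 (smooth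
  representations of compact totally disconnected groups: `V = ⊕_ξ V[ξ]`, `V^{K₀} = ⊕_{ξ|K₀ = 1} V[ξ]`).
* [Serre1977] J.-P. Serre, *Linear representations of finite groups*, GTM 42 (1977), §2.6 Thm. 8 (canonical
  decomposition and the isotypic projectors `p_i = (n_i/g) Σ χ_i(t)⁻¹ ρ(t)`), §2.3 (orthogonality of characters).
-/

set_option autoImplicit false

noncomputable section

open scoped BigOperators

namespace Literature.RepresentationTheory.TwistedCoinv

/-! ## §1. Finite abelian groups: isotypic projectors and the trace identity -/

section Finite

variable {A : Type*} [CommGroup A] [Fintype A] {W : Type*} [AddCommGroup W] [Module ℂ W]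
  (τ : Representation ℂ A W)

omit [Fintype A] in
/-- Values of a complex character of a finite abelian group are non-zero. [cite: Serre1977, §2.3] -/
theorem addChar_apply_ne_zero (ψ : AddChar (Additive A) ℂ) (a : Additive A) : ψ a ≠ 0 :=
  (ψ.val_isUnit a).ne_zero

/-- Values of a complex character of a finite abelian group have norm one (they are roots of unity).
[cite: Serre1977, §2.3] -/
theorem norm_addChar_apply (ψ : AddChar (Additive A) ℂ) (a : Additive A) : ‖ψ a‖ = 1 := by
  have h : ψ a ^ addOrderOf a = 1 := by
    rw [← AddChar.map_nsmul_eq_pow, addOrderOf_nsmul_eq_zero, AddChar.map_zero_eq_one]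
  exact Complex.norm_eq_one_of_pow_eq_one h (addOrderOf_pos a).ne'

omit [Fintype A] in
/-- `ψ(t⁻¹ a)⁻¹ = ψ(t) ψ(a)⁻¹`. [cite: Serre1977, §2.3] -/
theorem addChar_ofMul_inv_mul_inv (ψ : AddChar (Additive A) ℂ) (t a : A) :
    (ψ (Additive.ofMul (t⁻¹ * a)))⁻¹ = ψ (Additive.ofMul t) * (ψ (Additive.ofMul a))⁻¹ := by
  rw [ofMul_mul, ofMul_inv, AddChar.map_add_eq_mul, AddChar.map_neg_eq_inv, mul_inv, inv_inv]

/-- **Equivariance of the isotypic sum**: `τ(t) ∘ Σ_a ψ(a)⁻¹ τ(a) = ψ(t) · Σ_a ψ(a)⁻¹ τ(a)` (re-index `a ↦ t⁻¹ a`).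
[cite: Serre1977, §2.6 Thm. 8] -/
theorem mul_sum_smul_eq (ψ : AddChar (Additive A) ℂ) (t : A) :
    τ t * ∑ a : A, (ψ (Additive.ofMul a))⁻¹ • τ a =
      ψ (Additive.ofMul t) • ∑ a : A, (ψ (Additive.ofMul a))⁻¹ • τ a := by
  rw [Finset.mul_sum, Finset.smul_sum]
  simp_rw [mul_smul_comm, ← map_mul]
  -- re-index by `a ↦ t⁻¹ * a`
  rw [← Equiv.sum_comp (Equiv.mulLeft t⁻¹)]
  refine Finset.sum_congr rfl fun a _ => ?_
  rw [Equiv.coe_mulLeft, mul_inv_cancel_left, addChar_ofMul_inv_mul_inv, mul_smul]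

/-- **Orthogonality**: `Σ_ψ Σ_a ψ(a)⁻¹ τ(a) = |A| · 1` (the inner sum over characters is `|A| [a = 1]`,
Mathlib `AddChar.sum_apply_eq_ite`). [cite: Serre1977, §2.3] -/
theorem sum_sum_smul_eq :
    ∑ ψ : AddChar (Additive A) ℂ, ∑ a : A, (ψ (Additive.ofMul a))⁻¹ • τ a = (Fintype.card A : ℂ) • (1 : Module.End ℂ W) := by
  classical
  rw [Finset.sum_comm]
  simp_rw [← Finset.sum_smul, ← AddChar.map_neg_eq_inv]
  have h : ∀ a : A, ∑ ψ : AddChar (Additive A) ℂ, ψ (-Additive.ofMul a) =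
      if a = 1 then (Fintype.card A : ℂ) else 0 := fun a => by
    rw [AddChar.sum_apply_eq_ite]
    by_cases ha : a = 1
    · subst ha
      simp
    · have hne : ¬(-Additive.ofMul a = 0) := by rwa [neg_eq_zero, ofMul_eq_zero]
      rw [if_neg hne, if_neg ha]
  simp_rw [h, ite_smul, zero_smul, Finset.sum_ite_eq', Finset.mem_univ, if_true, map_one]

/-- The isotypic sum maps into the weight space of `ψ`. [cite: Serre1977, §2.6 Thm. 8] -/
theorem sum_smul_apply_mem_weightSpace (ψ : AddChar (Additive A) ℂ) (w : W) :
    (∑ a : A, (ψ (Additive.ofMul a))⁻¹ • τ a) w ∈ weightSpace τ id (fun a => ψ (Additive.ofMul a)) := by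
  rw [mem_weightSpace]
  intro t
  have := congrArg (fun f : Module.End ℂ W => f w) (mul_sum_smul_eq τ ψ t)
  simpa only [Module.End.mul_apply, LinearMap.smul_apply, id] using this

/-- On the weight space of `ψ` the isotypic sum is multiplication by `|A|`. [cite: Serre1977, §2.6 Thm. 8] -/
theorem sum_smul_apply_of_mem_weightSpace (ψ : AddChar (Additive A) ℂ) {w : W}
    (hw : w ∈ weightSpace τ id (fun a => ψ (Additive.ofMul a))) :
    (∑ a : A, (ψ (Additive.ofMul a))⁻¹ • τ a) w = (Fintype.card A : ℂ) • w := by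
  rw [mem_weightSpace] at hw
  rw [LinearMap.sum_apply]
  simp_rw [LinearMap.smul_apply]
  have h : ∀ a : A, (ψ (Additive.ofMul a))⁻¹ • τ a w = w := fun a => by
    rw [show τ a w = τ (id a) w from rfl, hw a, smul_smul, inv_mul_cancel₀ (addChar_apply_ne_zero ψ _), one_smul]
  simp_rw [h, Finset.sum_const, Finset.card_univ, ← Nat.cast_smul_eq_nsmul ℂ]

/-- **The normalised isotypic sum `|A|⁻¹ Σ_a ψ(a)⁻¹ τ(a)` is a projection onto the weight space of `ψ`.**
[cite: Serre1977, §2.6 Thm. 8] -/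
theorem isProj_weightSpace (ψ : AddChar (Additive A) ℂ) :
    LinearMap.IsProj (weightSpace τ id (fun a => ψ (Additive.ofMul a)))
      ((Fintype.card A : ℂ)⁻¹ • ∑ a : A, (ψ (Additive.ofMul a))⁻¹ • τ a) := by
  have hc : (Fintype.card A : ℂ) ≠ 0 := Nat.cast_ne_zero.2 Fintype.card_ne_zero
  refine ⟨fun w => ?_, fun w hw => ?_⟩
  · rw [LinearMap.smul_apply]
    exact Submodule.smul_mem _ _ (sum_smul_apply_mem_weightSpace τ ψ w)
  · rw [LinearMap.smul_apply, sum_smul_apply_of_mem_weightSpace τ ψ hw, smul_smul, inv_mul_cancel₀ hc, one_smul]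

variable [FiniteDimensional ℂ W]

/-- The trace of the normalised isotypic sum is the dimension of the weight space. [cite: Serre1977, §2.6 Thm. 8] -/
theorem trace_smul_sum_smul_eq_finrank (ψ : AddChar (Additive A) ℂ) :
    LinearMap.trace ℂ W ((Fintype.card A : ℂ)⁻¹ • ∑ a : A, (ψ (Additive.ofMul a))⁻¹ • τ a) =
      (Module.finrank ℂ (weightSpace τ id (fun a => ψ (Additive.ofMul a))) : ℂ) :=
  (isProj_weightSpace τ ψ).trace

/-- **The trace identity**: `tr τ(t) = Σ_ψ ψ(t) · dim W[ψ]`, the sum over the complex characters `ψ` of the finite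
abelian group `A` (`W[ψ]` the weight space of `ψ`). [cite: Serre1977, §2.6 Thm. 8] -/
theorem trace_eq_sum_finrank_weightSpace (t : A) :
    LinearMap.trace ℂ W (τ t) = ∑ ψ : AddChar (Additive A) ℂ,
      ψ (Additive.ofMul t) * (Module.finrank ℂ (weightSpace τ id (fun a => ψ (Additive.ofMul a))) : ℂ) := by
  have hc : (Fintype.card A : ℂ) ≠ 0 := Nat.cast_ne_zero.2 Fintype.card_ne_zero
  have h1 : τ t = τ t * ((Fintype.card A : ℂ)⁻¹ • ∑ ψ : AddChar (Additive A) ℂ,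
      ∑ a : A, (ψ (Additive.ofMul a))⁻¹ • τ a) := by
    rw [sum_sum_smul_eq, smul_smul, inv_mul_cancel₀ hc, one_smul, mul_one]
  rw [h1, Finset.smul_sum, Finset.mul_sum, map_sum]
  refine Finset.sum_congr rfl fun ψ _ => ?_
  rw [mul_smul_comm, mul_sum_smul_eq, smul_comm, map_smul, trace_smul_sum_smul_eq_finrank, smul_eq_mul]

/-- **Vanishing of the trace under a period of the weight multiplicities**: if `dim W[ψ] = dim W[ψ η]` for every
character `ψ`, then `tr τ(t) = 0` for every `t` with `η(t) ≠ 1` (re-indexing the trace identity by `ψ ↦ ψ η`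
multiplies it by `η(t)`). [cite: Serre1977, §2.6 Thm. 8] -/
theorem trace_eq_zero_of_finrank_weightSpace_periodic (η : AddChar (Additive A) ℂ)
    (hper : ∀ ψ : AddChar (Additive A) ℂ,
      Module.finrank ℂ (weightSpace τ id (fun a => ψ (Additive.ofMul a))) =
        Module.finrank ℂ (weightSpace τ id (fun a => (ψ * η) (Additive.ofMul a))))
    (t : A) (ht : η (Additive.ofMul t) ≠ 1) : LinearMap.trace ℂ W (τ t) = 0 := by
  have h := trace_eq_sum_finrank_weightSpace τ t
  have h2 : LinearMap.trace ℂ W (τ t) = η (Additive.ofMul t) * LinearMap.trace ℂ W (τ t) := by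
    conv_lhs => rw [h, ← Equiv.sum_comp (Equiv.mulRight η)]
    rw [h, Finset.mul_sum]
    refine Finset.sum_congr rfl fun ψ _ => ?_
    rw [Equiv.coe_mulRight, ← hper ψ, AddChar.mul_apply]
    ring
  have h3 : (1 - η (Additive.ofMul t)) * LinearMap.trace ℂ W (τ t) = 0 := by
    rw [sub_mul, one_mul, ← h2, sub_self]
  exact (mul_eq_zero.1 h3).resolve_left (sub_ne_zero.2 (Ne.symm ht))

end Finite

/-! ## §2. Compact groups: the `K₀`-fixed vectors of a smooth representation -/

section Compact

variable {K : Type*} [Group K] [TopologicalSpace K] [IsTopologicalGroup K] [CompactSpace K]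
  {S : Type*} [AddCommGroup S] [Module ℂ S] (ρ : Representation ℂ K S)

omit [TopologicalSpace K] [IsTopologicalGroup K] [CompactSpace K] in
/-- If the elements of `K` commute, every `ρ t` preserves the `K₀`-fixed vectors `S^{K₀}`.
[cite: BernsteinZelevinsky1976, §2.1] -/
theorem apply_mem_fixedPoints_of_comm (hcomm : ∀ a b : K, a * b = b * a) (K₀ : Subgroup K) (t : K)
    (x : S) (hx : x ∈ ρ.fixedPoints K₀) : ρ t x ∈ ρ.fixedPoints K₀ := by
  rw [Representation.mem_fixedPoints] at hx ⊢
  intro g hg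
  rw [← Module.End.mul_apply, ← map_mul, hcomm g t, map_mul, Module.End.mul_apply, hx g hg]

omit [TopologicalSpace K] [IsTopologicalGroup K] [CompactSpace K] in
/-- If the elements of `K` commute, every subgroup is normal. (Bookkeeping.) [folklore] -/
private theorem normal_of_comm (hcomm : ∀ a b : K, a * b = b * a) (K₀ : Subgroup K) : K₀.Normal :=
  ⟨fun n hn g => by rwa [hcomm g n, mul_inv_cancel_right]⟩

omit [TopologicalSpace K] [IsTopologicalGroup K] [CompactSpace K] in
/-- The weight function `k ↦ ψ(k K₀)` of a character `ψ` of `K/K₀` is `1` on `K₀`. [folklore] -/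
private theorem addChar_ofMul_mk_eq_one_of_mem (K₀ : Subgroup K) [K₀.Normal] (ψ : AddChar (Additive (K ⧸ K₀)) ℂ)
    {k : K} (hk : k ∈ K₀) : ψ (Additive.ofMul (k : K ⧸ K₀)) = 1 := by
  rw [(QuotientGroup.eq_one_iff k).2 hk, ofMul_one, AddChar.map_zero_eq_one]

omit [TopologicalSpace K] [IsTopologicalGroup K] [CompactSpace K] in
/-- A vector in the weight space of the weight function `k ↦ ψ(k K₀)` is `K₀`-fixed. [cite: BernsteinZelevinsky1976, §2.1] -/
theorem mem_fixedPoints_of_mem_weightSpace_mk (K₀ : Subgroup K) [K₀.Normal]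
    (ψ : AddChar (Additive (K ⧸ K₀)) ℂ) {v : S}
    (hv : v ∈ weightSpace ρ id (fun k => ψ (Additive.ofMul (k : K ⧸ K₀)))) : v ∈ ρ.fixedPoints K₀ := by
  rw [Representation.mem_fixedPoints]
  intro g hg
  rw [mem_weightSpace] at hv
  rw [show ρ g v = ρ (id g) v from rfl, hv g, addChar_ofMul_mk_eq_one_of_mem K₀ ψ hg, one_smul]

omit [CompactSpace K] in
/-- A character of `K` trivial on an open subgroup `K₀` is continuous (it factors through the discrete quotient
`K/K₀`; a character with open kernel is smooth). [cite: BernsteinZelevinsky1976, §2.1] -/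
theorem continuous_coe_of_le_ker (ξ : K →* ℂˣ) (K₀ : Subgroup K) [K₀.Normal] (hK₀ : IsOpen (K₀ : Set K))
    (hle : K₀ ≤ ξ.ker) : Continuous fun u => ((ξ u : ℂˣ) : ℂ) := by
  haveI : DiscreteTopology (K ⧸ K₀) := QuotientGroup.discreteTopology hK₀
  have hf : (fun u => ((ξ u : ℂˣ) : ℂ)) =
      (fun a : K ⧸ K₀ => ((QuotientGroup.lift K₀ ξ hle a : ℂˣ) : ℂ)) ∘ (QuotientGroup.mk : K → K ⧸ K₀) := by
    funext u
    simp only [Function.comp_apply, QuotientGroup.lift_mk]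
  rw [hf]
  exact continuous_of_discreteTopology.comp QuotientGroup.continuous_mk

omit [TopologicalSpace K] [IsTopologicalGroup K] [CompactSpace K] in
/-- A character of `K` trivial on a finite-index subgroup `K₀` is unitary: its values are `[K:K₀]`-th roots of unity
(values of characters of the finite group `K/K₀`). [cite: Serre1977, §2.1 Prop. 1] -/
theorem norm_coe_eq_one_of_le_ker (ξ : K →* ℂˣ) (K₀ : Subgroup K) [K₀.Normal] [Finite (K ⧸ K₀)]
    (hle : K₀ ≤ ξ.ker) (u : K) : ‖((ξ u : ℂˣ) : ℂ)‖ = 1 := by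
  have hn : (u : K ⧸ K₀) ^ Nat.card (K ⧸ K₀) = 1 := pow_card_eq_one'
  rw [← QuotientGroup.mk_pow, QuotientGroup.eq_one_iff] at hn
  have h1 : ((ξ u : ℂˣ) : ℂ) ^ Nat.card (K ⧸ K₀) = 1 := by
    rw [← Units.val_pow_eq_pow_val, ← map_pow, hle hn, Units.val_one]
  exact Complex.norm_eq_one_of_pow_eq_one h1 Nat.card_pos.ne'

/-- **Finite-dimensionality of the `K₀`-fixed vectors** (core form).  Let `K` be a compact group whose elements
commute, `ρ` a representation of `K` on a complex vector space `S`, and `K₀ ≤ K` an open subgroup such that the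
weight space (isotypic subspace) of every character TRIVIAL ON `K₀` is finite-dimensional.  Then `S^{K₀}` is
finite-dimensional: it is the sum, over the finitely many characters `ψ` of the finite group `K/K₀`, of the weight
spaces of `k ↦ ψ(k K₀)` (the isotypic sums of §1 add up to `|K/K₀| · 1` on `S^{K₀}`).
[cite: BernsteinZelevinsky1976, §2.1–2.3] -/
theorem finite_fixedPoints_of_finite_weightSpace (hcomm : ∀ a b : K, a * b = b * a)
    (K₀ : Subgroup K) (hK₀ : IsOpen (K₀ : Set K))
    (hfin : ∀ χ : K →* ℂˣ, K₀ ≤ χ.ker → Module.Finite ℂ (weightSpace ρ id (fun k => ((χ k : ℂˣ) : ℂ)))) :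
    Module.Finite ℂ (ρ.fixedPoints K₀) := by
  classical
  haveI : K₀.Normal := normal_of_comm hcomm K₀
  haveI : Finite (K ⧸ K₀) := Subgroup.quotient_finite_of_isOpen K₀ hK₀
  letI : Fintype (K ⧸ K₀) := Fintype.ofFinite _
  letI : CommGroup (K ⧸ K₀) :=
    { (inferInstance : Group (K ⧸ K₀)) with
      mul_comm := fun x y => by
        obtain ⟨a, rfl⟩ := QuotientGroup.mk_surjective x
        obtain ⟨b, rfl⟩ := QuotientGroup.mk_surjective y
        rw [← QuotientGroup.mk_mul, ← QuotientGroup.mk_mul, hcomm] }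
  -- the weight spaces in `S` of the characters of `K/K₀` are finite-dimensional
  set E : AddChar (Additive (K ⧸ K₀)) ℂ → Submodule ℂ S :=
    fun ψ => weightSpace ρ id (fun k => ψ (Additive.ofMul (k : K ⧸ K₀))) with hE
  have hEfin : ∀ ψ, Module.Finite ℂ (E ψ) := by
    intro ψ
    -- the unit-valued character `ξ_ψ : K →* ℂˣ`
    let ξ : K →* ℂˣ :=
      { toFun := fun k => Units.mk0 (ψ (Additive.ofMul (k : K ⧸ K₀))) ((ψ.val_isUnit _).ne_zero)
        map_one' := by ext; simp
        map_mul' := fun a b => by ext; simp [AddChar.map_add_eq_mul] }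
    have hξ : K₀ ≤ ξ.ker := fun k hk => by
      rw [MonoidHom.mem_ker]
      ext
      simp [ξ, addChar_ofMul_mk_eq_one_of_mem K₀ ψ hk]
    have hEq : weightSpace ρ id (fun k => ((ξ k : ℂˣ) : ℂ)) = E ψ := rfl
    rw [← hEq]
    exact hfin ξ hξ
  -- `S^{K₀} ≤ ⨆_ψ E ψ`
  have hle : ρ.fixedPoints K₀ ≤ ⨆ ψ : AddChar (Additive (K ⧸ K₀)) ℂ, E ψ := by
    intro w hw
    -- the restricted action of `K/K₀` on `S^{K₀}` is not needed: work in `S` with the sums over `K/K₀`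
    have hc : (Fintype.card (K ⧸ K₀) : ℂ) ≠ 0 := Nat.cast_ne_zero.2 Fintype.card_ne_zero
    -- the representative-independent operator `q ↦ ρ q.out` agrees with `ρ` on `S^{K₀}` up to `K₀`
    have hsum : (Fintype.card (K ⧸ K₀) : ℂ) • w =
        ∑ ψ : AddChar (Additive (K ⧸ K₀)) ℂ, ∑ q : K ⧸ K₀, (ψ (Additive.ofMul q))⁻¹ • ρ q.out w := by
      rw [Finset.sum_comm]
      simp_rw [← Finset.sum_smul, ← AddChar.map_neg_eq_inv]
      have h : ∀ q : K ⧸ K₀, ∑ ψ : AddChar (Additive (K ⧸ K₀)) ℂ, ψ (-Additive.ofMul q) =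
          if q = 1 then (Fintype.card (K ⧸ K₀) : ℂ) else 0 := fun q => by
        rw [AddChar.sum_apply_eq_ite]
        by_cases hq : q = 1
        · subst hq
          simp
        · have hne : ¬(-Additive.ofMul q = 0) := by rwa [neg_eq_zero, ofMul_eq_zero]
          rw [if_neg hne, if_neg hq]
      simp_rw [h, ite_smul, zero_smul, Finset.sum_ite_eq', Finset.mem_univ, if_true]
      -- `ρ (1 : K/K₀).out w = w` since `(1 : K/K₀).out ∈ K₀`
      have h1 : ((1 : K ⧸ K₀).out : K) ∈ K₀ := by
        rw [← QuotientGroup.eq_one_iff, QuotientGroup.out_eq']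
      rw [(Representation.mem_fixedPoints ρ K₀ w).1 hw _ h1]
    have hmem : ∀ ψ : AddChar (Additive (K ⧸ K₀)) ℂ,
        (∑ q : K ⧸ K₀, (ψ (Additive.ofMul q))⁻¹ • ρ q.out w) ∈ E ψ := by
      intro ψ
      rw [hE, mem_weightSpace]
      intro t
      simp only [id, map_sum, map_smul, Finset.smul_sum]
      -- re-index by `q ↦ (t : K/K₀)⁻¹ * q`
      rw [← Equiv.sum_comp (Equiv.mulLeft ((t : K ⧸ K₀)⁻¹))]
      refine Finset.sum_congr rfl fun q _ => ?_
      rw [Equiv.coe_mulLeft, ← Module.End.mul_apply, ← map_mul]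
      -- `t * ((t⁻¹ q).out)` and `q.out` differ by an element of `K₀`
      have hK : (t * ((t : K ⧸ K₀)⁻¹ * q).out : K) * (q.out : K)⁻¹ ∈ K₀ := by
        rw [← QuotientGroup.eq_one_iff, QuotientGroup.mk_mul, QuotientGroup.mk_mul, QuotientGroup.out_eq',
          QuotientGroup.mk_inv, QuotientGroup.out_eq', mul_inv_cancel_left, mul_inv_cancel]
      have hfix := (Representation.mem_fixedPoints ρ K₀ w).1 hw _ hK
      have hρ : ρ (t * ((t : K ⧸ K₀)⁻¹ * q).out) w = ρ q.out w := by
        set X : K := t * ((t : K ⧸ K₀)⁻¹ * q).out with hX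
        calc ρ X w = ρ (X * (q.out : K)⁻¹ * q.out) w := by rw [inv_mul_cancel_right]
          _ = ρ (q.out * (X * (q.out : K)⁻¹)) w := by rw [hcomm]
          _ = ρ q.out (ρ (X * (q.out : K)⁻¹) w) := by rw [map_mul, Module.End.mul_apply]
          _ = ρ q.out w := by rw [hfix]
      rw [hρ, smul_smul, ofMul_mul, ofMul_inv, AddChar.map_add_eq_mul, AddChar.map_neg_eq_inv, mul_inv, inv_inv]
    have hw' : w = (Fintype.card (K ⧸ K₀) : ℂ)⁻¹ •
        ∑ ψ : AddChar (Additive (K ⧸ K₀)) ℂ, ∑ q : K ⧸ K₀, (ψ (Additive.ofMul q))⁻¹ • ρ q.out w := by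
      rw [← hsum, smul_smul, inv_mul_cancel₀ hc, one_smul]
    rw [hw']
    exact Submodule.smul_mem _ _ (Submodule.sum_mem _ fun ψ _ => Submodule.mem_iSup_of_mem ψ (hmem ψ))
  haveI : ∀ ψ, Module.Finite ℂ ↥(E ψ) := hEfin
  haveI : Module.Finite ℂ ↥(⨆ ψ : AddChar (Additive (K ⧸ K₀)) ℂ, E ψ) := inferInstance
  exact Module.Finite.of_injective (Submodule.inclusion hle) (Submodule.inclusion_injective hle)

/-- **Finite-dimensionality of the `K₀`-fixed vectors from multiplicity one, rank form** (piece (M2a)): if the weight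
space of every open-kernel character has rank `≤ 1`, then `S^{K₀}` is finite-dimensional for every open subgroup `K₀`.
[cite: BernsteinZelevinsky1976, §2.1–2.3] -/
theorem finite_fixedPoints_of_rank_weightSpace_le (hcomm : ∀ a b : K, a * b = b * a)
    (hmult : ∀ χ : K →* ℂˣ, IsOpen (χ.ker : Set K) →
      Module.rank ℂ (weightSpace ρ id (fun k => ((χ k : ℂˣ) : ℂ))) ≤ 1)
    (K₀ : Subgroup K) (hK₀ : IsOpen (K₀ : Set K)) : Module.Finite ℂ (ρ.fixedPoints K₀) :=
  finite_fixedPoints_of_finite_weightSpace ρ hcomm K₀ hK₀ fun χ hχ =>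
    Module.rank_lt_aleph0_iff.1
      (lt_of_le_of_lt (hmult χ (Subgroup.isOpen_mono hχ hK₀)) Cardinal.one_lt_aleph0)

/-- **Finite-dimensionality of the `K₀`-fixed vectors from multiplicity one, unitary-continuous form** (piece (M2a) in
the shape of the rank-one multiplicity-one junction: every unitary continuous character has a finite-dimensional weight
space of dimension `≤ 1`). [cite: BernsteinZelevinsky1976, §2.1–2.3] -/
theorem finite_fixedPoints_of_finiteDimensional_weightSpace (hcomm : ∀ a b : K, a * b = b * a)
    (hmult : ∀ χ : K →* ℂˣ, (∀ u, ‖((χ u : ℂˣ) : ℂ)‖ = 1) → (Continuous fun u => ((χ u : ℂˣ) : ℂ)) →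
      FiniteDimensional ℂ (weightSpace ρ id (fun k => ((χ k : ℂˣ) : ℂ))) ∧
        Module.finrank ℂ (weightSpace ρ id (fun k => ((χ k : ℂˣ) : ℂ))) ≤ 1)
    (K₀ : Subgroup K) (hK₀ : IsOpen (K₀ : Set K)) : Module.Finite ℂ (ρ.fixedPoints K₀) := by
  haveI : K₀.Normal := normal_of_comm hcomm K₀
  haveI : Finite (K ⧸ K₀) := Subgroup.quotient_finite_of_isOpen K₀ hK₀
  exact finite_fixedPoints_of_finite_weightSpace ρ hcomm K₀ hK₀ fun χ hχ =>
    (hmult χ (norm_coe_eq_one_of_le_ker χ K₀ hχ) (continuous_coe_of_le_ker χ K₀ hK₀ hχ)).1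

omit [TopologicalSpace K] [IsTopologicalGroup K] [CompactSpace K] in
/-- **Weight spaces of `S^{K₀}` versus weight spaces of `S`.**  For a representation `τ` of `K/K₀` on `S^{K₀}` through
which `ρ` acts (`τ(k K₀) w = ρ(k) w`) and a character `ψ` of `K/K₀`, the weight space of `ψ` in `S^{K₀}` and the
weight space of `k ↦ ψ(k K₀)` in `S` have the same dimension (the inclusion `S^{K₀} ⊆ S` restricts to a linear
bijection: every vector of the latter weight space is `K₀`-fixed). [cite: BernsteinZelevinsky1976, §2.1–2.3] -/
theorem finrank_weightSpace_quotient_eq (K₀ : Subgroup K) [K₀.Normal]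
    (τ : Representation ℂ (K ⧸ K₀) (ρ.fixedPoints K₀))
    (hτ : ∀ (k : K) (w : ρ.fixedPoints K₀), ((τ (k : K ⧸ K₀) w : ρ.fixedPoints K₀) : S) = ρ k w)
    (ψ : AddChar (Additive (K ⧸ K₀)) ℂ) :
    Module.finrank ℂ (weightSpace τ id (fun a => ψ (Additive.ofMul a))) =
      Module.finrank ℂ (weightSpace ρ id (fun k => ψ (Additive.ofMul (k : K ⧸ K₀)))) := by
  -- the inclusion
  have hmem : ∀ x : weightSpace τ id (fun a => ψ (Additive.ofMul a)),
      ((x : ρ.fixedPoints K₀) : S) ∈ weightSpace ρ id (fun k => ψ (Additive.ofMul (k : K ⧸ K₀))) := by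
    intro x
    rw [mem_weightSpace]
    intro k
    have hx := apply_of_mem_weightSpace x.2 (k : K ⧸ K₀)
    rw [id] at hx
    rw [id, ← hτ k, hx, Submodule.coe_smul]
  let f : weightSpace τ id (fun a => ψ (Additive.ofMul a)) →ₗ[ℂ]
      weightSpace ρ id (fun k => ψ (Additive.ofMul (k : K ⧸ K₀))) :=
    { toFun := fun x => ⟨((x : ρ.fixedPoints K₀) : S), hmem x⟩
      map_add' := fun x y => by ext; simp
      map_smul' := fun c x => by ext; simp }
  have hinj : Function.Injective f := by
    intro x y hxy
    have h := congrArg (fun z : weightSpace ρ id (fun k => ψ (Additive.ofMul (k : K ⧸ K₀))) => (z : S)) hxy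
    exact Subtype.ext (Subtype.ext h)
  have hsurj : Function.Surjective f := by
    intro v
    have hvW : (v : S) ∈ ρ.fixedPoints K₀ := mem_fixedPoints_of_mem_weightSpace_mk ρ K₀ ψ v.2
    have hvE : (⟨(v : S), hvW⟩ : ρ.fixedPoints K₀) ∈ weightSpace τ id (fun a => ψ (Additive.ofMul a)) := by
      rw [mem_weightSpace]
      intro a
      obtain ⟨k, rfl⟩ := QuotientGroup.mk_surjective a
      apply Subtype.ext
      have hv := apply_of_mem_weightSpace v.2 k
      rw [id] at hv
      rw [id, hτ k, Submodule.coe_smul, hv]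
    exact ⟨⟨⟨(v : S), hvW⟩, hvE⟩, Subtype.ext rfl⟩
  exact (LinearEquiv.ofBijective f ⟨hinj, hsurj⟩).finrank_eq

/-- **The finite-level trace identity vanishes under a period** (piece (M2c)).  Let `K` be a compact group whose
elements commute, `ρ` a representation of `K` on `S`, `K₀ ≤ K` an open subgroup with `S^{K₀}` finite-dimensional,
and `η : K →* ℂˣ` a character trivial on `K₀` such that the weight multiplicities are `η`-PERIODIC on the characters
trivial on `K₀`: `dim S[ξ] = dim S[ξ η]` whenever `K₀ ≤ ker ξ`.  Then `tr (ρ(t) | S^{K₀}) = 0` for every `t` with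
`η(t) ≠ 1`.  (Trace identity `tr (ρ(t)|S^{K₀}) = Σ_ψ ψ(t) dim S[ψ]` over the characters of `K/K₀`, re-indexed by
`ψ ↦ ψ η`.) [cite: Serre1977, §2.6 Thm. 8] -/
theorem trace_fixedPoints_eq_zero_of_periodic (hcomm : ∀ a b : K, a * b = b * a)
    (K₀ : Subgroup K) (hK₀ : IsOpen (K₀ : Set K)) (hW : Module.Finite ℂ (ρ.fixedPoints K₀))
    (η : K →* ℂˣ) (hK₀η : K₀ ≤ η.ker)
    (hper : ∀ ξ : K →* ℂˣ, K₀ ≤ ξ.ker →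
      Module.finrank ℂ (weightSpace ρ id (fun k => ((ξ k : ℂˣ) : ℂ))) =
        Module.finrank ℂ (weightSpace ρ id (fun k => (((ξ * η) k : ℂˣ) : ℂ))))
    (t : K) (ht : η t ≠ 1) (h : ∀ x ∈ ρ.fixedPoints K₀, ρ t x ∈ ρ.fixedPoints K₀) :
    LinearMap.trace ℂ (ρ.fixedPoints K₀) ((ρ t).restrict h) = 0 := by
  classical
  haveI : K₀.Normal := normal_of_comm hcomm K₀
  haveI : Finite (K ⧸ K₀) := Subgroup.quotient_finite_of_isOpen K₀ hK₀
  letI : Fintype (K ⧸ K₀) := Fintype.ofFinite _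
  letI : CommGroup (K ⧸ K₀) :=
    { (inferInstance : Group (K ⧸ K₀)) with
      mul_comm := fun x y => by
        obtain ⟨a, rfl⟩ := QuotientGroup.mk_surjective x
        obtain ⟨b, rfl⟩ := QuotientGroup.mk_surjective y
        rw [← QuotientGroup.mk_mul, ← QuotientGroup.mk_mul, hcomm] }
  haveI := hW
  -- the representation of `K/K₀` on `S^{K₀}`
  let τ₀ : K →* Module.End ℂ (ρ.fixedPoints K₀) :=
    { toFun := fun k => (ρ k).restrict (fun x hx => apply_mem_fixedPoints_of_comm ρ hcomm K₀ k x hx)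
      map_one' := by
        ext w
        simp
      map_mul' := fun a b => by
        ext w
        simp }
  have hτ₀ : K₀ ≤ τ₀.ker := by
    intro k hk
    rw [MonoidHom.mem_ker]
    ext w
    simpa [τ₀] using (Representation.mem_fixedPoints ρ K₀ (w : S)).1 w.2 k hk
  let τ : Representation ℂ (K ⧸ K₀) (ρ.fixedPoints K₀) := QuotientGroup.lift K₀ τ₀ hτ₀
  have hτ : ∀ (k : K) (w : ρ.fixedPoints K₀), ((τ (k : K ⧸ K₀) w : ρ.fixedPoints K₀) : S) = ρ k w := by
    intro k w
    simp [τ, τ₀, QuotientGroup.lift_mk]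
  have hτt : τ (t : K ⧸ K₀) = (ρ t).restrict h := by
    simp [τ, τ₀, QuotientGroup.lift_mk]
  -- the character of `K/K₀` induced by `η`
  have hηker : K₀ ≤ ((Units.coeHom ℂ).comp η).ker := fun k hk => by
    rw [MonoidHom.mem_ker, MonoidHom.comp_apply, hK₀η hk, map_one]
  let ηbar : AddChar (Additive (K ⧸ K₀)) ℂ :=
    { toFun := fun x => QuotientGroup.lift K₀ ((Units.coeHom ℂ).comp η) hηker (Additive.toMul x)
      map_zero_eq_one' := by simp
      map_add_eq_mul' := fun a b => by simp [toMul_add] }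
  have hηbar : ∀ k : K, ηbar (Additive.ofMul (k : K ⧸ K₀)) = ((η k : ℂˣ) : ℂ) := fun k => by
    simp [ηbar, QuotientGroup.lift_mk]
  have ht' : ηbar (Additive.ofMul (t : K ⧸ K₀)) ≠ 1 := by
    rw [hηbar]
    exact fun h1 => ht (Units.val_eq_one.1 h1)
  -- periodicity of the weight multiplicities of `τ`
  have hper' : ∀ ψ : AddChar (Additive (K ⧸ K₀)) ℂ,
      Module.finrank ℂ (weightSpace τ id (fun a => ψ (Additive.ofMul a))) =
        Module.finrank ℂ (weightSpace τ id (fun a => (ψ * ηbar) (Additive.ofMul a))) := by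
    intro ψ
    rw [finrank_weightSpace_quotient_eq ρ K₀ τ hτ ψ, finrank_weightSpace_quotient_eq ρ K₀ τ hτ (ψ * ηbar)]
    -- the unit-valued character `ξ_ψ : K →* ℂˣ`
    let ξ : K →* ℂˣ :=
      { toFun := fun k => Units.mk0 (ψ (Additive.ofMul (k : K ⧸ K₀))) ((ψ.val_isUnit _).ne_zero)
        map_one' := by ext; simp
        map_mul' := fun a b => by ext; simp [AddChar.map_add_eq_mul] }
    have hξ : K₀ ≤ ξ.ker := fun k hk => by
      rw [MonoidHom.mem_ker]
      ext
      simp [ξ, addChar_ofMul_mk_eq_one_of_mem K₀ ψ hk]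
    have h1 : (fun k : K => ((ξ k : ℂˣ) : ℂ)) = fun k : K => ψ (Additive.ofMul (k : K ⧸ K₀)) := rfl
    have h2 : (fun k : K => (((ξ * η) k : ℂˣ) : ℂ)) =
        fun k : K => (ψ * ηbar) (Additive.ofMul (k : K ⧸ K₀)) := by
      funext k
      rw [MonoidHom.mul_apply, Units.val_mul, AddChar.mul_apply, hηbar]
      rfl
    have h3 := hper ξ hξ
    rw [h1, h2] at h3
    exact h3
  have h0 := trace_eq_zero_of_finrank_weightSpace_periodic τ ηbar hper' (t : K ⧸ K₀) ht'
  rwa [hτt] at h0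

/-- **Vanishing of the finite-level trace under a period of the type set** (core form of piece (M2d)).  Let `K` be a
compact group whose elements commute, `ρ` a SMOOTH representation on `S`, `K₀ ≤ K` an open subgroup with
MULTIPLICITY ONE ON THE CHARACTERS TRIVIAL ON `K₀` (their weight spaces are finite-dimensional of dimension `≤ 1`),
and `η : K →* ℂˣ` trivial on `K₀` such that the TYPE SET is `η`-periodic in the coinvariant form: for every unitary
continuous character `ξ`, `Coinv ρ ξ ≠ 0 ↔ Coinv ρ (ξ η) ≠ 0`.  Then `tr (ρ(t) | S^{K₀}) = 0` for every `t` with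
`η(t) ≠ 1`.  (For `K₀ ≤ ker ξ` the character `ξ` is unitary and continuous and its weight space IS its coinvariants,
`exists_linearEquiv_weightSpace_coinv`, of dimension `0` or `1`; so the hypothesis gives `dim S[ξ] = dim S[ξ η]` and
`trace_fixedPoints_eq_zero_of_periodic` applies.) [cite: BernsteinZelevinsky1976, §2.1–2.3] -/
theorem trace_fixedPoints_eq_zero_of_coinv_periodic_of_le_ker (hρ : ρ.IsSmooth)
    (hcomm : ∀ a b : K, a * b = b * a) (K₀ : Subgroup K) (hK₀ : IsOpen (K₀ : Set K))
    (hmult : ∀ χ : K →* ℂˣ, K₀ ≤ χ.ker →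
      Module.Finite ℂ (weightSpace ρ id (fun k => ((χ k : ℂˣ) : ℂ))) ∧
        Module.finrank ℂ (weightSpace ρ id (fun k => ((χ k : ℂˣ) : ℂ))) ≤ 1)
    (η : K →* ℂˣ) (hK₀η : K₀ ≤ η.ker)
    (hper : ∀ ξ : K →* ℂˣ, (∀ u, ‖((ξ u : ℂˣ) : ℂ)‖ = 1) → (Continuous fun u => ((ξ u : ℂˣ) : ℂ)) →
      (Nontrivial (Coinv ρ ξ) ↔ Nontrivial (Coinv ρ (ξ * η))))
    (t : K) (ht : η t ≠ 1) (h : ∀ x ∈ ρ.fixedPoints K₀, ρ t x ∈ ρ.fixedPoints K₀) :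
    LinearMap.trace ℂ (ρ.fixedPoints K₀) ((ρ t).restrict h) = 0 := by
  haveI : K₀.Normal := normal_of_comm hcomm K₀
  haveI : Finite (K ⧸ K₀) := Subgroup.quotient_finite_of_isOpen K₀ hK₀
  refine trace_fixedPoints_eq_zero_of_periodic ρ hcomm K₀ hK₀
    (finite_fixedPoints_of_finite_weightSpace ρ hcomm K₀ hK₀ fun χ hχ => (hmult χ hχ).1) η hK₀η
    (fun ξ hξ => ?_) t ht h
  -- `ξ` and `ξ η` are trivial on `K₀`, hence open-kernel, unitary and continuous
  have hξη : K₀ ≤ (ξ * η).ker := fun k hk => by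
    rw [MonoidHom.mem_ker, MonoidHom.mul_apply, hξ hk, hK₀η hk, one_mul]
  -- dimensions are `0` or `1`, and the weight space is the coinvariants
  have hdim : ∀ χ : K →* ℂˣ, K₀ ≤ χ.ker →
      Module.finrank ℂ (weightSpace ρ id (fun k => ((χ k : ℂˣ) : ℂ))) ≤ 1 ∧
        (0 < Module.finrank ℂ (weightSpace ρ id (fun k => ((χ k : ℂˣ) : ℂ))) ↔ Nontrivial (Coinv ρ χ)) := by
    intro χ hχ
    obtain ⟨hf, hr⟩ := hmult χ hχ
    haveI := hf
    refine ⟨hr, ?_⟩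
    rw [Module.finrank_pos_iff_of_free]
    obtain ⟨e, -⟩ := exists_linearEquiv_weightSpace_coinv ρ χ hρ (Subgroup.isOpen_mono hχ hK₀)
    exact ⟨fun hn => by haveI := hn; exact e.injective.nontrivial,
      fun hn => by haveI := hn; exact e.symm.injective.nontrivial⟩
  have hiff := hper ξ (norm_coe_eq_one_of_le_ker ξ K₀ hξ) (continuous_coe_of_le_ker ξ K₀ hK₀ hξ)
  obtain ⟨h1, h1'⟩ := hdim ξ hξ
  obtain ⟨h2, h2'⟩ := hdim (ξ * η) hξη
  have key : 0 < Module.finrank ℂ (weightSpace ρ id (fun k => ((ξ k : ℂˣ) : ℂ))) ↔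
      0 < Module.finrank ℂ (weightSpace ρ id (fun k => (((ξ * η) k : ℂˣ) : ℂ))) := by
    rw [h1', h2', hiff]
  omega

/-- **Vanishing of the finite-level trace under a period of the type set, rank form** (piece (M2d), the form announced
for the non-periodicity assembly): multiplicity one as «every open-kernel character has weight space of rank `≤ 1`»,
periodicity of the type set in the coinvariant form, `K₀ ≤ ker η` open, `η(t) ≠ 1` ⟹ `tr (ρ(t) | S^{K₀}) = 0`.
[cite: BernsteinZelevinsky1976, §2.1–2.3] -/
theorem trace_fixedPoints_eq_zero_of_coinv_periodic (hρ : ρ.IsSmooth) (hcomm : ∀ a b : K, a * b = b * a)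
    (hmult : ∀ χ : K →* ℂˣ, IsOpen (χ.ker : Set K) →
      Module.rank ℂ (weightSpace ρ id (fun k => ((χ k : ℂˣ) : ℂ))) ≤ 1)
    (η : K →* ℂˣ)
    (hper : ∀ ξ : K →* ℂˣ, (∀ u, ‖((ξ u : ℂˣ) : ℂ)‖ = 1) → (Continuous fun u => ((ξ u : ℂˣ) : ℂ)) →
      (Nontrivial (Coinv ρ ξ) ↔ Nontrivial (Coinv ρ (ξ * η))))
    (K₀ : Subgroup K) (hK₀ : IsOpen (K₀ : Set K)) (hK₀η : K₀ ≤ η.ker)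
    (t : K) (ht : η t ≠ 1) (h : ∀ x ∈ ρ.fixedPoints K₀, ρ t x ∈ ρ.fixedPoints K₀) :
    LinearMap.trace ℂ (ρ.fixedPoints K₀) ((ρ t).restrict h) = 0 := by
  refine trace_fixedPoints_eq_zero_of_coinv_periodic_of_le_ker ρ hρ hcomm K₀ hK₀ (fun χ hχ => ?_) η hK₀η hper t ht h
  have hr := hmult χ (Subgroup.isOpen_mono hχ hK₀)
  haveI : Module.Finite ℂ (weightSpace ρ id (fun k => ((χ k : ℂˣ) : ℂ))) :=
    Module.rank_lt_aleph0_iff.1 (lt_of_le_of_lt hr Cardinal.one_lt_aleph0)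
  exact ⟨inferInstance, Module.finrank_le_of_rank_le (by exact_mod_cast hr)⟩

/-- **Vanishing of the finite-level trace under a period of the type set, unitary-continuous form** (piece (M2d) in the
shape of the rank-one multiplicity-one junction: every unitary continuous character has a finite-dimensional weight
space of dimension `≤ 1`). [cite: BernsteinZelevinsky1976, §2.1–2.3] -/
theorem trace_fixedPoints_eq_zero_of_coinv_periodic' (hρ : ρ.IsSmooth) (hcomm : ∀ a b : K, a * b = b * a)
    (hmult : ∀ χ : K →* ℂˣ, (∀ u, ‖((χ u : ℂˣ) : ℂ)‖ = 1) → (Continuous fun u => ((χ u : ℂˣ) : ℂ)) →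
      FiniteDimensional ℂ (weightSpace ρ id (fun k => ((χ k : ℂˣ) : ℂ))) ∧
        Module.finrank ℂ (weightSpace ρ id (fun k => ((χ k : ℂˣ) : ℂ))) ≤ 1)
    (η : K →* ℂˣ)
    (hper : ∀ ξ : K →* ℂˣ, (∀ u, ‖((ξ u : ℂˣ) : ℂ)‖ = 1) → (Continuous fun u => ((ξ u : ℂˣ) : ℂ)) →
      (Nontrivial (Coinv ρ ξ) ↔ Nontrivial (Coinv ρ (ξ * η))))
    (K₀ : Subgroup K) (hK₀ : IsOpen (K₀ : Set K)) (hK₀η : K₀ ≤ η.ker)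
    (t : K) (ht : η t ≠ 1) (h : ∀ x ∈ ρ.fixedPoints K₀, ρ t x ∈ ρ.fixedPoints K₀) :
    LinearMap.trace ℂ (ρ.fixedPoints K₀) ((ρ t).restrict h) = 0 := by
  haveI : K₀.Normal := normal_of_comm hcomm K₀
  haveI : Finite (K ⧸ K₀) := Subgroup.quotient_finite_of_isOpen K₀ hK₀
  exact trace_fixedPoints_eq_zero_of_coinv_periodic_of_le_ker ρ hρ hcomm K₀ hK₀
    (fun χ hχ => hmult χ (norm_coe_eq_one_of_le_ker χ K₀ hχ) (continuous_coe_of_le_ker χ K₀ hK₀ hχ))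
    η hK₀η hper t ht h

end Compact



end Literature.RepresentationTheory.TwistedCoinv

end
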